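import Literature.NumberTheory.NumberFields.RingClassFieldOfConductor
import Literature.NumberTheory.QuadraticFields.LatticeSumPrincipal
import Literature.NumberTheory.QuadraticFields.HeegnerCondition
import Mathlib.NumberTheory.LegendreSymbol.JacobiSymbol
import HarnessLib

/-!
# The genus characters `(q*/·)` are trivial on `P_{K,ℤ}(f)`: a prime of trivial ring class has
# norm `≡ n² (mod f)`, hence `(d / N𝔭) = 1` for every `d ≡ 1 (mod 4)` with `|d| ∣ f`
# (Cox, *Primes of the form x² + ny²*, §7.C Lemma 7.18, Thm. 6.1 / Lemma 1.14; Gauss's genus theory)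

Topic `NumberTheory/QuadraticFields`, namespace `Literature.NumberTheory.QuadraticFields.RingClass`
(continuing `RingClassGroup.lean`, `RingClassNumber.lean`; the class `primeClass f v = [𝔭_v]` of
`NumberFields/RingClassFieldOfConductor.lean`). Theorems only (no definition, no named fact), fully
proved:

* `exists_generator_of_primeClass_eq_one` — for ANY number field `K`: a prime `𝔭 ∤ f` with
  `[𝔭] = 1` in `I_K(f)/P_{K,ℤ}(f)` is principal, `𝔭 = (a)`, with `a ≡ n (mod f𝓞_K)` for an integer
  `n` prime to `f` (Cox §9.A / Thm. 9.2: "`[𝔭] = 1` means `𝔭 = (α)(β)⁻¹` with `α ≡ a`, `β ≡ b`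
  integers prime to `f`; then `α/β ∈ 𝔭` generates `𝔭` and `(α/β) b ≡ a`" — the argument of the
  tree's `RingClassField.exists_ringClassField_data_principal`, isolated as a statement about
  `primeClass`);
* `dvd_norm_sub_sq_of_sub_intCast_mem` — for a QUADRATIC `K`: `a ≡ n (mod f𝓞_K)` implies
  `N_{K/ℚ}(a) ≡ n² (mod f)` (Cox Lemma 7.18: `N(α) ≡ a² (mod f)`; on an integral basis `(1, ω)`,
  `N(x + yω) = x² + txy − my²` with `f ∣ x − n`, `f ∣ y`);
  `dvd_absNorm_span_singleton_sub_sq` — the same for `N𝔭 = |N(a)| = N(a)` when `d_K < 0`;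
* `jacobiSym_eq_one_of_dvd_sub_sq` / `isSquare_intCast_zmod_of_dvd_sub_sq` — the reciprocity step:
  for `d ≡ 1 (mod 4)` (a product of prime discriminants `q*`), an odd prime `ℓ ∤ d` and `n` prime
  to `d` with `ℓ ≡ n² (mod d)`, `(d/ℓ) = (ℓ/|d|) = (n²/|d|) = 1`, so `d` is a square modulo `ℓ`
  (Jacobi reciprocity in Mathlib: `jacobiSym.quadratic_reciprocity_one_mod_four`,
  `…_three_mod_four`, `jacobiSym.neg`; Cox Lemma 1.14 / Thm. 6.1: `(d/·)` is a character mod `|d|`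
  for `d ≡ 1 (mod 4)`);
* `isSquare_intCast_zmod_absNorm_of_primeClass_eq_one` — **assembled**: for `K` imaginary
  quadratic (`[K:ℚ] = 2`, `d_K < 0`), `d ≡ 1 (mod 4)` with `|d| ∣ f`, and a prime `𝔭 ∤ f` of
  `K` of odd prime norm `ℓ` with `[𝔭] = 1` in `I_K(f)/P_{K,ℤ}(f)`: `d` is a square modulo `ℓ`
  (and `ℓ ∤ d`) — i.e. the genus character `χ_d = (d/N·)` kills the principal class (Cox Thm. 6.1 /
  §3.B Lemma 3.17 for forms: the genus characters are trivial on the principal genus).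

This is the arithmetic half of the genus theory of ring class fields
(`EllipticCurves/RingClassFieldGenusProofs.lean`: `√d ∈ K[f]` for `|d| ∣ f`).

## References

* D. A. Cox, *Primes of the form x² + ny²*, 2nd ed. (2013): §1.C Lemma 1.14, §3.B Lemma 3.17,
  §6.A Thm. 6.1, §7.C Lemma 7.18 and Prop. 7.22, §9.A Thm. 9.2. [Cox2013]
-/

noncomputable section

open scoped nonZeroDivisors
open Module NumberField IsDedekindDomain

namespace Literature.NumberTheory.QuadraticFields.RingClass

open Literature.NumberTheory.NumberFields.RingClassField
open Literature.NumberTheory.QuadraticFields.Quadratic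

/-! ### A prime of trivial ring class is principal with a generator `≡ n (mod f)` -/

section Principal

variable {K : Type} [Field K] [NumberField K] (f : ℕ)

/-- **`[𝔭] = 1` in `I_K(f)/P_{K,ℤ}(f)` means `𝔭 = (a)` with `a ≡ n (mod f𝓞_K)`, `n ∈ ℤ` prime to
`f`** (for a prime `𝔭 ∤ f` of any number field `K`): `[𝔭] = 1` says `𝔭 = (α)(β)⁻¹` with
`α ≡ a`, `β ≡ b (mod f𝓞_K)` for integers `a, b` prime to `f`; then `a' := α/β ∈ 𝔭 ⊆ 𝓞_K`
generates `𝔭` and `a' ≡ a b' (mod f)` for `b b' ≡ 1 (mod f)` (Cox §9.A: the primes of trivial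
class are those `= α𝒪_K`, `α ∈ ℤ + f𝒪_K` prime to `f`). The argument of the tree's
`RingClassField.exists_ringClassField_data_principal`, stated for `primeClass` itself.
[cite: Cox2013, §9.A Thm. 9.2 and §7.C Prop. 7.22] -/
theorem exists_generator_of_primeClass_eq_one {v : HeightOneSpectrum (𝓞 K)}
    (hv : ¬ Ideal.span {(f : 𝓞 K)} ≤ v.asIdeal) (h1 : primeClass f v = 1) :
    ∃ (a : 𝓞 K) (n : ℤ), IsCoprime n (f : ℤ) ∧ v.asIdeal = Ideal.span {a} ∧
      a - (n : 𝓞 K) ∈ Ideal.span {(f : 𝓞 K)} := by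
  classical
  have hcop : v.asIdeal ⊔ Ideal.span {(f : 𝓞 K)} = ⊤ := (sup_span_eq_top_iff_not_le f).mpr hv
  rw [primeClass_of_sup_eq_top f hcop, idealClass_eq, QuotientGroup.eq_one_iff,
    Subgroup.mem_subgroupOf] at h1
  -- `𝔭_v = g h⁻¹` with `g, h` generators of `P_{K,ℤ}(f)`
  obtain ⟨g, hg, h, hh, hgh⟩ := exists_eq_mul_inv_of_mem_ringClassDen h1
  obtain ⟨α, a, ha, hαa, hgα⟩ := hg
  obtain ⟨β, b, hb, hβb, hhβ⟩ := hh
  have hβ0 : β ≠ 0 := by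
    rintro rfl
    have : ((h : (FractionalIdeal (𝓞 K)⁰ K)ˣ) : FractionalIdeal (𝓞 K)⁰ K) = 0 := by
      rw [hhβ]; simp
    exact Units.ne_zero h this
  -- the fractional ideal `𝔭_v · (β) = (α)`
  have hβK : (β : K) ≠ 0 := RingOfIntegers.coe_ne_zero_iff.mpr hβ0
  have hvfrac : ((v.asIdeal : FractionalIdeal (𝓞 K)⁰ K)) *
      FractionalIdeal.spanSingleton (𝓞 K)⁰ (β : K) =
        FractionalIdeal.spanSingleton (𝓞 K)⁰ (α : K) := by
    have hval := congrArg (fun u : (FractionalIdeal (𝓞 K)⁰ K)ˣ => (u : FractionalIdeal (𝓞 K)⁰ K)) hgh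
    simp only [Units.val_mul, Units.val_inv_eq_inv_val, FractionalIdeal.coe_mk0] at hval
    rw [hgα, hhβ] at hval
    rw [eq_mul_inv_iff_mul_eq₀ (by
      rw [Ne, FractionalIdeal.spanSingleton_eq_zero_iff]; exact hβK)] at hval
    exact hval
  -- `a' := α / β` lies in `𝓞 K` and generates `𝔭_v`
  have hspan : (v.asIdeal : FractionalIdeal (𝓞 K)⁰ K) =
      FractionalIdeal.spanSingleton (𝓞 K)⁰ ((α : K) / (β : K)) := by
    rw [div_eq_mul_inv, ← FractionalIdeal.spanSingleton_mul_spanSingleton, ← hvfrac, mul_assoc,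
      FractionalIdeal.spanSingleton_mul_spanSingleton, mul_inv_cancel₀ hβK,
      FractionalIdeal.spanSingleton_one, mul_one]
  have hmem : (α : K) / (β : K) ∈ (v.asIdeal : FractionalIdeal (𝓞 K)⁰ K) := by
    rw [hspan]; exact FractionalIdeal.mem_spanSingleton_self _ _
  rw [FractionalIdeal.mem_coeIdeal] at hmem
  obtain ⟨a', -, ha'⟩ := hmem
  refine ⟨a', ?_⟩
  have hva' : v.asIdeal = Ideal.span {a'} := by
    apply FractionalIdeal.coeIdeal_injective (K := K)
    show (v.asIdeal : FractionalIdeal (𝓞 K)⁰ K) =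
      ((Ideal.span {a'} : Ideal (𝓞 K)) : FractionalIdeal (𝓞 K)⁰ K)
    rw [hspan, FractionalIdeal.coeIdeal_span_singleton, ha']
  -- congruence: `a' β = α`, `β ≡ b`, `α ≡ a`; choose `b'` with `b b' ≡ 1 (mod f)`
  have hab : a' * β = α := by
    apply RingOfIntegers.coe_injective
    rw [map_mul, ha', div_mul_cancel₀ _ hβK]
  obtain ⟨b', k, hbk⟩ := hb
  refine ⟨a * b', ?_, hva', ?_⟩
  · have hb'cop : IsCoprime b' (f : ℤ) := ⟨b, k, by linear_combination hbk⟩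
    exact IsCoprime.mul_left ha hb'cop
  · have h1 : a' - ((a * b' : ℤ) : 𝓞 K) =
        a' * ((k * (f : ℤ) : ℤ) : 𝓞 K) + (b' : 𝓞 K) * (α - (a : 𝓞 K)) -
          a' * (b' : 𝓞 K) * (β - (b : 𝓞 K)) := by
      have hk : ((k * (f : ℤ) : ℤ) : 𝓞 K) = 1 - (b' : 𝓞 K) * (b : 𝓞 K) := by
        have := congrArg (fun z : ℤ => (z : 𝓞 K)) hbk
        push_cast at this ⊢
        linear_combination this
      rw [hk, ← hab]
      push_cast
      ring
    rw [h1]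
    refine Submodule.sub_mem _ (Submodule.add_mem _ ?_ (Ideal.mul_mem_left _ _ hαa))
      (Ideal.mul_mem_left _ _ hβb)
    have : ((k * (f : ℤ) : ℤ) : 𝓞 K) = (k : 𝓞 K) * (f : 𝓞 K) := by push_cast; ring
    rw [this]
    exact Ideal.mul_mem_left _ _ (Ideal.mul_mem_left _ _ (Ideal.mem_span_singleton_self _))

end Principal

/-! ### `a ≡ n (mod f𝓞_K)` forces `N(a) ≡ n² (mod f)` in a quadratic field -/

section Norm

variable {K : Type*} [Field K] [NumberField K]

/-- **Cox, Lemma 7.18: `N(α) ≡ n² (mod f)` for `α ≡ n (mod f𝓞_K)`** in a quadratic field `K`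
(`[K:ℚ] = 2`): on an integral basis `(1, ω)`, `ω² = m + tω`, write `α = x + yω`; then
`f ∣ x − n`, `f ∣ y` and `N(α) = x² + txy − my² ≡ n² (mod f)`.
[cite: Cox2013, §7.C Lemma 7.18] -/
theorem dvd_norm_sub_sq_of_sub_intCast_mem (h2 : finrank ℚ K = 2) {f : ℕ} {a : 𝓞 K} {n : ℤ}
    (h : a - (n : 𝓞 K) ∈ Ideal.span {(f : 𝓞 K)}) :
    (f : ℤ) ∣ Algebra.norm ℤ a - n ^ 2 := by
  obtain ⟨b, hb⟩ := exists_basis_zero_eq_one (K := K) h2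
  set m : ℤ := b.repr (b 1 * b 1) 0 with hm
  set t : ℤ := b.repr (b 1 * b 1) 1 with ht
  have hω : b 1 * b 1 = (m : 𝓞 K) + (t : 𝓞 K) * b 1 := basis_one_mul_self_eq b hb
  set x : ℤ := b.repr a 0 with hx
  set y : ℤ := b.repr a 1 with hy
  have ha : a = (x : 𝓞 K) + (y : 𝓞 K) * b 1 := eq_repr_add_repr_mul_of_basis b hb a
  -- coordinates of `a - n = (x - n) + y ω`
  have hsub : a - (n : 𝓞 K) = ((x - n : ℤ) : 𝓞 K) + (y : 𝓞 K) * b 1 := by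
    rw [ha]; push_cast; ring
  have h0 : (f : ℤ) ∣ x - n := by
    have := dvd_repr_of_mem_span (f := f) b h 0
    rwa [hsub, repr_intCast_add_intCast_mul_zero b hb] at this
  have h1 : (f : ℤ) ∣ y := by
    have := dvd_repr_of_mem_span (f := f) b h 1
    rwa [hsub, repr_intCast_add_intCast_mul_one b hb] at this
  rw [ha, norm_intCast_add_intCast_mul b hb hω x y]
  obtain ⟨c, hc⟩ := h0
  obtain ⟨e, he⟩ := h1
  have hx' : x = n + f * c := by linarith
  rw [hx', he]
  exact ⟨2 * n * c + f * c ^ 2 + t * n * e + t * f * c * e - m * f * e ^ 2, by ring⟩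

/-- In an imaginary quadratic field (`[K:ℚ] = 2`, `d_K < 0`) norms are non-negative, so
`N𝔭 = N(a)` for `𝔭 = (a)`: hence **`f ∣ N(a) − n²`** as integers for `a ≡ n (mod f𝓞_K)`, with
`N(a) = Ideal.absNorm (a)`. [cite: Cox2013, §7.C Lemma 7.18 and §7.B (7.16)] -/
theorem dvd_absNorm_span_singleton_sub_sq (h2 : finrank ℚ K = 2) (hneg : NumberField.discr K < 0)
    {f : ℕ} {a : 𝓞 K} {n : ℤ} (h : a - (n : 𝓞 K) ∈ Ideal.span {(f : 𝓞 K)}) :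
    (f : ℤ) ∣ (Ideal.absNorm (Ideal.span {a}) : ℤ) - n ^ 2 := by
  have hnn : 0 ≤ Algebra.norm ℤ a := by
    obtain ⟨b, hb⟩ := exists_basis_zero_eq_one (K := K) h2
    set m : ℤ := b.repr (b 1 * b 1) 0 with hm
    set t : ℤ := b.repr (b 1 * b 1) 1 with ht
    have hω : b 1 * b 1 = (m : 𝓞 K) + (t : 𝓞 K) * b 1 := basis_one_mul_self_eq b hb
    have hD : NumberField.discr K = t ^ 2 + 4 * m := discr_eq_sq_add_four_mul b hb
    rw [eq_repr_add_repr_mul_of_basis b hb a, norm_intCast_add_intCast_mul b hb hω]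
    nlinarith [sq_nonneg (2 * b.repr a 0 + t * b.repr a 1), sq_nonneg (b.repr a 1), hD, hneg]
  rw [Ideal.absNorm_span_singleton, Int.natCast_natAbs, abs_of_nonneg hnn]
  exact dvd_norm_sub_sq_of_sub_intCast_mem h2 h

end Norm

/-! ### Reciprocity: `ℓ ≡ n² (mod d)`, `d ≡ 1 (mod 4)` ⟹ `(d/ℓ) = 1` -/

section Jacobi

/-- **`(d/ℓ) = 1` for an odd prime `ℓ ≡ n² (mod d)`, `d ≡ 1 (mod 4)`, `(n, d) = (ℓ, d) = 1`.**
For `d > 0`: `(d/ℓ) = (ℓ/d) = (n²/d) = 1`; for `d < 0` (`|d| ≡ 3 (mod 4)`):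
`(d/ℓ) = (−1/ℓ)(|d|/ℓ) = χ₄(ℓ) · (±(ℓ/|d|)) = 1` in both cases `ℓ ≡ 1, 3 (mod 4)` (Jacobi
reciprocity; Cox Lemma 1.14: for `D ≡ 1 (mod 4)` the symbol `(D/·)` is a character modulo `|D|`
with `(D/p) = (p/q)`-type reciprocity). [cite: Cox2013, §1.C Lemma 1.14 and §6.A Thm. 6.1] -/
theorem jacobiSym_eq_one_of_dvd_sub_sq {d : ℤ} (hd4 : d % 4 = 1) {ℓ : ℕ} (hℓ : ℓ.Prime)
    (hℓ2 : ℓ ≠ 2) {n : ℤ} (hn : Int.gcd n d = 1) (hmod : d ∣ (ℓ : ℤ) - n ^ 2) :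
    jacobiSym d ℓ = 1 := by
  have hℓodd : Odd ℓ := hℓ.odd_of_ne_two hℓ2
  set M : ℕ := d.natAbs with hM
  have hd0 : d ≠ 0 := by rintro rfl; norm_num at hd4
  have hMd : (M : ℤ) ∣ d := Int.natAbs_dvd.mpr dvd_rfl
  -- `J(ℓ | M) = J(n² | M) = 1`
  have hnM : n.gcd M = 1 := by
    rw [Int.gcd_eq_natAbs, Int.natAbs_natCast]
    rw [Int.gcd_eq_natAbs] at hn
    exact hn
  have hℓM : jacobiSym ℓ M = 1 := by
    have hmod' : (ℓ : ℤ) % (M : ℕ) = (n ^ 2) % (M : ℕ) := by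
      have hdvd : (M : ℤ) ∣ (ℓ : ℤ) - n ^ 2 := hMd.trans hmod
      have hdvd' : (M : ℤ) ∣ n ^ 2 - (ℓ : ℤ) := by rw [← neg_sub]; exact hdvd.neg_right
      exact Int.modEq_iff_dvd.mpr hdvd'
    rw [jacobiSym.mod_left' hmod', jacobiSym.sq_one' hnM]
  -- case split on the sign of `d`
  rcases lt_or_gt_of_ne hd0 with hneg | hpos
  · -- `d = -M`, `M ≡ 3 (mod 4)`
    have hdM : d = -(M : ℤ) := by rw [hM, Int.natCast_natAbs, abs_of_neg hneg, neg_neg]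
    have hM4 : M % 4 = 3 := by omega
    have hModd : Odd M := Nat.odd_iff.mpr (by omega)
    rw [hdM, jacobiSym.neg _ hℓodd]
    rcases Nat.odd_mod_four_iff.mp (Nat.odd_iff.mp hℓodd) with hℓ1 | hℓ3
    · rw [ZMod.χ₄_nat_one_mod_four hℓ1, jacobiSym.quadratic_reciprocity_one_mod_four' hModd hℓ1,
        hℓM, one_mul]
    · rw [ZMod.χ₄_nat_three_mod_four hℓ3, jacobiSym.quadratic_reciprocity_three_mod_four hM4 hℓ3,
        hℓM]
      norm_num
  · -- `d = M ≡ 1 (mod 4)`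
    have hdM : d = (M : ℤ) := by rw [hM, Int.natCast_natAbs, abs_of_pos hpos]
    have hM4 : M % 4 = 1 := by omega
    rw [hdM, jacobiSym.quadratic_reciprocity_one_mod_four hM4 hℓodd, hℓM]

/-- Hence **`d` is a (non-zero) square modulo `ℓ`** under the same hypotheses.
[cite: Cox2013, §1.C Lemma 1.14 and §6.A Thm. 6.1] -/
theorem isSquare_intCast_zmod_of_dvd_sub_sq {d : ℤ} (hd4 : d % 4 = 1) {ℓ : ℕ} (hℓ : ℓ.Prime)
    (hℓ2 : ℓ ≠ 2) {n : ℤ} (hn : Int.gcd n d = 1) (hmod : d ∣ (ℓ : ℤ) - n ^ 2) :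
    IsSquare ((d : ZMod ℓ)) := by
  haveI : Fact ℓ.Prime := ⟨hℓ⟩
  exact ZMod.isSquare_of_jacobiSym_eq_one (jacobiSym_eq_one_of_dvd_sub_sq hd4 hℓ hℓ2 hn hmod)

end Jacobi

/-! ### Assembled: the genus character of `d` kills the principal class -/

section Genus

variable {K : Type} [Field K] [NumberField K]

/-- **The genus characters are trivial on `P_{K,ℤ}(f)`.** Let `K` be imaginary quadratic
(`[K:ℚ] = 2`, `d_K < 0`), `d ≡ 1 (mod 4)` with `|d| ∣ f`, and `𝔭 ∤ f` a prime of `K` of odd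
prime norm `ℓ` whose class in `I_K(f)/P_{K,ℤ}(f)` is trivial. Then `d` is a square modulo
`ℓ` (then automatically `ℓ ∤ d`): `𝔭 = (a)` with `a ≡ n (mod f)`, so `ℓ = N(a) ≡ n² (mod |d|)`
and `(d/ℓ) = (n²/|d|) = 1`
(Cox Thm. 6.1 / Lemma 3.17: the assigned characters `(q*/·)`, `q ∣ d`, are trivial on the
principal genus; here in the ideal-theoretic currency of §7.C). [cite: Cox2013, §6.A Thm. 6.1, §7.C Lemma 7.18, §9.A Thm. 9.2] -/
theorem isSquare_intCast_zmod_absNorm_of_primeClass_eq_one (h2 : finrank ℚ K = 2)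
    (hneg : NumberField.discr K < 0) {f : ℕ} {d : ℤ} (hd4 : d % 4 = 1) (hdf : d.natAbs ∣ f)
    {v : HeightOneSpectrum (𝓞 K)} (hv : ¬ Ideal.span {(f : 𝓞 K)} ≤ v.asIdeal)
    (h1 : primeClass f v = 1) {ℓ : ℕ} (hℓ : ℓ.Prime) (hℓ2 : ℓ ≠ 2)
    (hN : Ideal.absNorm v.asIdeal = ℓ) :
    IsSquare ((d : ZMod ℓ)) := by
  obtain ⟨a, n, hnf, hva, han⟩ := exists_generator_of_primeClass_eq_one f hv h1
  have hdvd : (f : ℤ) ∣ (Ideal.absNorm (Ideal.span {a}) : ℤ) - n ^ 2 :=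
    dvd_absNorm_span_singleton_sub_sq h2 hneg han
  rw [← hva, hN] at hdvd
  have hdf' : d ∣ (f : ℤ) := Int.natAbs_dvd.mp (Int.natCast_dvd_natCast.mpr hdf)
  -- `n` is prime to `d` since it is prime to `f` and `|d| ∣ f`
  have hn : Int.gcd n d = 1 := by
    have hnd : IsCoprime n d := hnf.of_isCoprime_of_dvd_right hdf'
    exact Int.isCoprime_iff_gcd_eq_one.mp hnd
  exact isSquare_intCast_zmod_of_dvd_sub_sq hd4 hℓ hℓ2 hn (hdf'.trans hdvd)

end Genus

end Literature.NumberTheory.QuadraticFields.RingClass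

end
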